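import Summits.HodgeConjecture.HodgeConjecture.Theorems.Ring2TransportWeilTypeEveryCMField
import Summits.HodgeConjecture.HodgeConjecture.Theorems.Ring2TransportLocalGermCMField
import Literature.AlgebraicGeometry.HodgeTheory.WeilClassesMoonenZarhinCriterionHolds
import HarnessLib

/-!
# Ring-2 transport, gen 5 (ν): the every-CM-field class target in CLOSED FORM, with the LOCAL and GERM rows

HONEST FRAMING (page 1, verbatim for the cell). Everything in this file is a RESEARCH ROUTE CONDITIONAL ON `HC_CM`
(`Theses.RankFourFaces.CMAbelianHodge`, an explicit binder `hCM`, never a fact); NOT a corollary of anything in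
print; Question 11.4 SENTENCE 2 of Markman's survey (the weak semiregularity criterion) is ALREADY REFUTED in
dimension ≥ 3 (`SemiregularityWeakCriterionAbelianCounterexample`, `…Full`) and is used nowhere below. The preprints
[M] arXiv:2502.03415, [S] arXiv:2509.23403, [C] arXiv:2509.23079, [P] arXiv:2604.00511 are UNREFEREED (statements
only, never inputs). No internally-minted statement is cited as a fact; every open input is an explicit hypothesis,
labelled ours/open.

WHAT THIS FILE DOES. Gen 5's every-CM-field class target `HodgeGeneralWeilTypeEveryCMField` (the Hodge conjecture for
every GENERAL abelian variety of Weil type relative to an ARBITRARY CM field `E = ℚ(η)`, every `[E:ℚ] = 2e₀ ≥ 2`, on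
Deligne's carriers `IsWeilTypeCM`; `Theorems/Ring2TransportWeilTypeEveryCMField.lean`) carried the binder
`(hMZ : MoonenZarhin1998_weilClasses_hodgeCriterion)`, now the kernel theorem
`HodgeTheory.MoonenZarhin1998_weilClasses_hodgeCriterion_holds` (`WeilClassesMoonenZarhinCriterionHolds.lean`). Here the
theorem is fed in (`*_closed` rows), and the LOCAL-germ and semiregular-CHERN-LIFT rows of the union class are recorded,
combining gen 1's quadratic local leaf `LocalWeilVHCAtCMQuadratic` / gen 5's `SemiregularChernLiftAtCMQuadratic C`
with the CM-field leaves `LocalWeilVHCAtCMField` / `SemiregularChernLiftAtCMField C`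
(`Theorems/Ring2TransportLocalGermCMField.lean`):
* `hodgeConjectureFor_weilTypeCM_one_closed` — `e₀ = 1`: #24 + R∞ + carrier data ⟹ `HC(A)`;
* `hodgeGeneralWeilTypeEveryCMField_iff_closed : (#24) → R∞ → (Every ↔ T6-CM)`;
  `hodgeGeneralWeilTypeEveryCMField_of_ladder_closed : (#24) → R∞ → R3 → Every`;
* `HC_GeneralWeilTypeEveryCMField_of_HC_CM_closed` (global leaves R∞var, R3var), `…_local_closed` (local germs at CM
  fibres), `…_of_semiregularChernLift_closed` (Chern lifts + Buchweitz–Flenner 2003 Thm. 5.1, REFEREED), and the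
  `HC_CM`-FREE twins through gen 2's divisor-generated CM anchors;
* `hodgeGeneralWeilTypeEveryCMField_closed_position`.
INPUT LEDGER of the union row after this file: `HC_CM` (binder, NOMINAL) · two supply leaves (quadratic, CM-field;
ours/open) · two transport leaves (ours/open; global ⟸ local germ ⟸ Chern lift + BF03) · fact #24
`Deligne1982_hodgeRing_weilTypeCM_of_hodgeGroupSU` (UNREFEREED ×2: Milne 2003 endnote 16; Milne 2025 Ex. 1.17 — at
`e₀ = 1` it is van Geemen's refereed Thm. 6.12 in different polarisation packaging, see the honest note of the union
file). Moonen–Zarhin and both descents (vG 4.9 at `e₀ = 1`, MZ Lemma (1) at `e₀ ≥ 2`) are THEOREMS.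

References (bib keys): Deligne1982HodgeCycles (§4 (4.4), Prop. 4.4, Thm. 4.8, §5, endnote 16), vanGeemen1994HodgeAV
(4.9, 6.11–6.12), MoonenZarhin1998WeilClasses (§1), BuchweitzFlenner2003 (§5 Thm. 5.1), CharlesSchnell2014Notes
(Conj. 11.3.1, Prop. 11.3.11), Gordon1997 (Thm. 6.4, §3), Markman2025SurveySecant ([S] §12 — preprint / ICM 2026
lecture, unrefereed, statements only).
-/

set_option linter.dupNamespace false

noncomputable section

open CategoryTheory

namespace Summit.HodgeConjecture.HodgeConjecture.Ring2Transport

open Literature.AlgebraicGeometry Literature.AlgebraicGeometry.Motives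
open Literature.AlgebraicGeometry.HodgeTheory
open Literature.AlgebraicGeometry.Deligne1982
open Literature.AlgebraicGeometry.VanGeemen1994 (pullbackOne hodgeClassSpan)
open Literature.AlgebraicTopology.SingularHomology
open Summit.HodgeConjecture.HodgeConjecture.Theses
open Summit.HodgeConjecture.HodgeConjecture.WeilTypeLadder

/-! ### §1 The `e₀ = 1` slice and the union node, closed form -/

/-- **`e₀ = 1`, closed form: #24 + R∞ + carrier data ⟹ `HC(A)`** (Moonen–Zarhin fed in; descent is vG 4.9, a theorem).
[cite: vanGeemen1994HodgeAV, 4.9 and Thm. 6.12] [cite: Deligne1982HodgeCycles, §4 (4.4)] -/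
theorem hodgeConjectureFor_weilTypeCM_one_closed (h24 : Deligne1982_hodgeRing_weilTypeCM_of_hodgeGroupSU)
    (hRq : WeilClassesImaginaryQuadratic) {A : AbelianVariety ℂ} {η : A ⟶ A} {R : Polynomial ℤ} {k : ℕ}
    {h : complexBetti A.X 2} (hW : IsWeilTypeCM A η R 1 k) (hpol : IsPolarizationClass A.dim A.X h)
    (hRos : ∀ x y : complexBetti A.X 1,
      polarizationPairingOne A.X h (A.dim - 1) (pullbackOne A η x) y =
        -polarizationPairingOne A.X h (A.dim - 1) x (pullbackOne A η y))
    (hSU : HasHodgeGroupSUCM A η (R.comp (Polynomial.X ^ 2)) h) : HodgeConjectureFor A.dim A.X :=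
  hodgeConjectureFor_weilTypeCM_one_of_weilClassesImaginaryQuadratic h24 MoonenZarhin1998_weilClasses_hodgeCriterion_holds
    hRq hW hpol hRos hSU

/-- **Exactness of the split, closed form: `(#24) → R∞ → (Every ↔ T6-CM)`.** [cite: Deligne1982HodgeCycles, §4 (4.4)]
[cite: vanGeemen1994HodgeAV, Thm. 6.12] -/
theorem hodgeGeneralWeilTypeEveryCMField_iff_closed (h24 : Deligne1982_hodgeRing_weilTypeCM_of_hodgeGroupSU)
    (hRq : WeilClassesImaginaryQuadratic) : HodgeGeneralWeilTypeEveryCMField ↔ HodgeGeneralWeilTypeCMField :=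
  hodgeGeneralWeilTypeEveryCMField_iff h24 MoonenZarhin1998_weilClasses_hodgeCriterion_holds hRq

/-- **`(#24) → R∞ → R3 → Every`, closed form.** [cite: Deligne1982HodgeCycles, §4 (4.4) and endnote 16]
[cite: MoonenZarhin1998WeilClasses, §1] [cite: vanGeemen1994HodgeAV, Thm. 6.12] -/
theorem hodgeGeneralWeilTypeEveryCMField_of_ladder_closed (h24 : Deligne1982_hodgeRing_weilTypeCM_of_hodgeGroupSU)
    (hRq : WeilClassesImaginaryQuadratic) (hR3 : WeilClassesCMField) : HodgeGeneralWeilTypeEveryCMField :=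
  hodgeGeneralWeilTypeEveryCMField_of_ladder h24 MoonenZarhin1998_weilClasses_hodgeCriterion_holds hRq hR3

/-! ### §2 The union row from `HC_CM`: global, local and germ transport leaves, closed form -/

/-- **Union row, global leaves, closed form: `HC_CM → (CM-pointed, quadratic) → R∞var → (CM-pointed, CM field) →
R3var → (#24) → Every`.** [cite: Deligne1982HodgeCycles, §4 proof of Thm. 4.8, §5, endnote 16]
[cite: CharlesSchnell2014Notes, Conj. 11.3.1] -/
theorem HC_GeneralWeilTypeEveryCMField_of_HC_CM_closed (hCM : Theses.RankFourFaces.CMAbelianHodge)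
    (hPq : CMPointedWeilFamiliesQuadratic) (hVq : WeilVariationalHodgeQuadratic)
    (hP : CMPointedWeilFamiliesCMField) (hV : WeilVariationalHodgeCMField)
    (h24 : Deligne1982_hodgeRing_weilTypeCM_of_hodgeGroupSU) : HodgeGeneralWeilTypeEveryCMField :=
  HC_GeneralWeilTypeEveryCMField_of_HC_CM hCM hPq hVq hP hV h24 MoonenZarhin1998_weilClasses_hodgeCriterion_holds

/-- **Union row, LOCAL germs at CM fibres, closed form: `HC_CM → (CM-pointed, quadratic) → LocalWeilVHCAtCMQuadratic →
(CM-pointed, CM field) → LocalWeilVHCAtCMField → (#24) → Every`** (Baire + Charles–Schnell in the tree, both rungs).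
[cite: CharlesSchnell2014Notes, Prop. 11.3.11 (proof)] [cite: BuchweitzFlenner2003, Thm. 5.1]
[cite: Deligne1982HodgeCycles, §4 (4.4), endnote 16] -/
theorem HC_GeneralWeilTypeEveryCMField_of_HC_CM_local_closed (hCM : Theses.RankFourFaces.CMAbelianHodge)
    (hPq : CMPointedWeilFamiliesQuadratic) (hLq : LocalWeilVHCAtCMQuadratic)
    (hP : CMPointedWeilFamiliesCMField) (hL : LocalWeilVHCAtCMField)
    (h24 : Deligne1982_hodgeRing_weilTypeCM_of_hodgeGroupSU) : HodgeGeneralWeilTypeEveryCMField :=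
  hodgeGeneralWeilTypeEveryCMField_of_ladder_closed h24 (HC_WeilClassesQuadratic_of_HC_CM_local hCM hPq hLq)
    (HC_WeilClassesCMField_of_HC_CM_local hCM hP hL)

/-- **Union row, semiregular CHERN LIFTS at CM fibres + Buchweitz–Flenner, closed form: `HC_CM → (CM-pointed ×2) →
SemiregularChernLiftAtCMQuadratic C → SemiregularChernLiftAtCMField C → BF2003 → (#24) → Every`.** Literature inputs:
Buchweitz–Flenner 2003 Thm. 5.1 (REFEREED, unformalised) and fact #24 (UNREFEREED ×2). [cite: BuchweitzFlenner2003, §5 Thm. 5.1]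
[cite: Deligne1982HodgeCycles, §4 (4.4), endnote 16] -/
theorem HC_GeneralWeilTypeEveryCMField_of_HC_CM_of_semiregularChernLift_closed (C : ChernCharacterBetti)
    (hCM : Theses.RankFourFaces.CMAbelianHodge) (hPq : CMPointedWeilFamiliesQuadratic)
    (hLq : SemiregularChernLiftAtCMQuadratic C) (hP : CMPointedWeilFamiliesCMField) (hL : SemiregularChernLiftAtCMField C)
    (hBF : BuchweitzFlenner2003_variationalHodge_ISemiregular)
    (h24 : Deligne1982_hodgeRing_weilTypeCM_of_hodgeGroupSU) : HodgeGeneralWeilTypeEveryCMField :=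
  HC_GeneralWeilTypeEveryCMField_of_HC_CM_local_closed hCM hPq (localWeilVHCAtCMQuadratic_of_semiregularChernLift C hBF hLq)
    hP (localWeilVHCAtCMField_of_semiregularChernLift C hBF hL) h24

/-- **Union row WITHOUT `HC_CM`, global leaves, closed form** (gen 2's divisor-generated CM anchors on both rungs;
`HC_CM` NOMINAL on the union row). [cite: vanGeemen1994HodgeAV, 2.4] [cite: Gordon1997, Thm. 6.4 and §3 Theorem]
[cite: Deligne1982HodgeCycles, §5, endnote 16] -/
theorem HC_GeneralWeilTypeEveryCMField_of_divisorGeneratedCMPointed_closed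
    (hPq : DivisorGeneratedCMPointedWeilFamiliesQuadratic) (hVq : WeilVariationalHodgeQuadratic)
    (hP : DivisorGeneratedCMPointedWeilFamiliesCMField) (hV : WeilVariationalHodgeCMField)
    (h24 : Deligne1982_hodgeRing_weilTypeCM_of_hodgeGroupSU) : HodgeGeneralWeilTypeEveryCMField :=
  HC_GeneralWeilTypeEveryCMField_of_divisorGeneratedCMPointed hPq hVq hP hV h24
    MoonenZarhin1998_weilClasses_hodgeCriterion_holds

/-- **Union row WITHOUT `HC_CM`, LOCAL germs, closed form.** [cite: Gordon1997, Thm. 6.4 and §3 Theorem]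
[cite: CharlesSchnell2014Notes, Prop. 11.3.11 (proof)] [cite: Deligne1982HodgeCycles, §4 (4.4), endnote 16] -/
theorem HC_GeneralWeilTypeEveryCMField_of_divisorGeneratedCMPointed_local_closed
    (hPq : DivisorGeneratedCMPointedWeilFamiliesQuadratic) (hLq : LocalWeilVHCAtCMQuadratic)
    (hP : DivisorGeneratedCMPointedWeilFamiliesCMField) (hL : LocalWeilVHCAtCMField)
    (h24 : Deligne1982_hodgeRing_weilTypeCM_of_hodgeGroupSU) : HodgeGeneralWeilTypeEveryCMField :=
  hodgeGeneralWeilTypeEveryCMField_of_ladder_closed h24 (HC_WeilClassesQuadratic_of_divisorGeneratedCMPointed_local hPq hLq)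
    (HC_WeilClassesCMField_of_divisorGeneratedCMPointed_local hP hL)

/-- **Union row WITHOUT `HC_CM`, Chern lifts + Buchweitz–Flenner, closed form.** [cite: Gordon1997, Thm. 6.4]
[cite: BuchweitzFlenner2003, §5 Thm. 5.1] [cite: Deligne1982HodgeCycles, §4 (4.4), endnote 16] -/
theorem HC_GeneralWeilTypeEveryCMField_of_divisorGeneratedCMPointed_of_semiregularChernLift_closed (C : ChernCharacterBetti)
    (hPq : DivisorGeneratedCMPointedWeilFamiliesQuadratic) (hLq : SemiregularChernLiftAtCMQuadratic C)
    (hP : DivisorGeneratedCMPointedWeilFamiliesCMField) (hL : SemiregularChernLiftAtCMField C)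
    (hBF : BuchweitzFlenner2003_variationalHodge_ISemiregular)
    (h24 : Deligne1982_hodgeRing_weilTypeCM_of_hodgeGroupSU) : HodgeGeneralWeilTypeEveryCMField :=
  HC_GeneralWeilTypeEveryCMField_of_divisorGeneratedCMPointed_local_closed hPq
    (localWeilVHCAtCMQuadratic_of_semiregularChernLift C hBF hLq) hP (localWeilVHCAtCMField_of_semiregularChernLift C hBF hL) h24

/-- **Position of the union row in closed form** (kernel-checked conjunction). [cite: Deligne1982HodgeCycles, §4 (4.4), endnote 16]
[cite: MoonenZarhin1998WeilClasses, §1] [cite: BuchweitzFlenner2003, §5 Thm. 5.1] -/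
theorem hodgeGeneralWeilTypeEveryCMField_closed_position (C : ChernCharacterBetti) :
    (PadicSemiregularLift.HodgeAbelianVarieties → HodgeGeneralWeilTypeEveryCMField) ∧
    (Deligne1982_hodgeRing_weilTypeCM_of_hodgeGroupSU → WeilClassesImaginaryQuadratic → WeilClassesCMField →
      HodgeGeneralWeilTypeEveryCMField) ∧
    (Theses.RankFourFaces.CMAbelianHodge → CMPointedWeilFamiliesQuadratic → LocalWeilVHCAtCMQuadratic →
      CMPointedWeilFamiliesCMField → LocalWeilVHCAtCMField → Deligne1982_hodgeRing_weilTypeCM_of_hodgeGroupSU →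
      HodgeGeneralWeilTypeEveryCMField) ∧
    (Theses.RankFourFaces.CMAbelianHodge → CMPointedWeilFamiliesQuadratic → SemiregularChernLiftAtCMQuadratic C →
      CMPointedWeilFamiliesCMField → SemiregularChernLiftAtCMField C → BuchweitzFlenner2003_variationalHodge_ISemiregular →
      Deligne1982_hodgeRing_weilTypeCM_of_hodgeGroupSU → HodgeGeneralWeilTypeEveryCMField) :=
  ⟨hodgeGeneralWeilTypeEveryCMField_of_hodgeAbelianVarieties, hodgeGeneralWeilTypeEveryCMField_of_ladder_closed,
    HC_GeneralWeilTypeEveryCMField_of_HC_CM_local_closed, HC_GeneralWeilTypeEveryCMField_of_HC_CM_of_semiregularChernLift_closed C⟩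

/-! ## Audit: nothing is decided here — every theorem whose conclusion is the union class has among its hypotheses OPEN
statements of ours (supply and transport leaves on both rungs, or the rungs R∞ / R3 themselves), the unformalised fact #24
(UNREFEREED ×2), on the germ rows the refereed unformalised fact `BuchweitzFlenner2003_variationalHodge_ISemiregular`, and
on the `HC_CM` rows `HC_CM` by name. Moonen–Zarhin's criterion and the descents are THEOREMS. Axioms: standard three. -/

#print axioms Summit.HodgeConjecture.HodgeConjecture.Ring2Transport.hodgeGeneralWeilTypeEveryCMField_iff_closed
#print axioms Summit.HodgeConjecture.HodgeConjecture.Ring2Transport.HC_GeneralWeilTypeEveryCMField_of_HC_CM_of_semiregularChernLift_closed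

end Summit.HodgeConjecture.HodgeConjecture.Ring2Transport

end
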